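import Mathlib
import Summits.Ventures.HodgeRepro.Tier4.Common.ConcreteWitness

/-!
# Tier4/Common/DeepLevel — deeper levels: `Γ′ ∩ Γ(N)` is again a level, and a level of a level is a level

Blind re-derivation cell `pub-hodge-repro`, Tier 4 (README §9–§10), seat t4-typer-1 (gen 1).  Target tree path
`lean/Summits/Ventures/HodgeRepro/Tier4/Common/DeepLevel.lean`.  Imports `ConcreteWitness` (typer-1 g0: `isUnitaryOf_one`,
`IsLevel.congr`, `IsLevel.subset`), hence `HeckeOnForms` (`IsUnitaryOf.mul`) and `HeckeInvariance`
(`IsCongruenceSubgroup.one_mem / mul_mem / exists_inv / isUnitaryOf`).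

WHY.  The conclusion of `P_T4` is existential in a level `Γ′ ≤ Γ` («for some choice of the Hecke translates» — a common
congruence cover); every line's datum carries a level, and the deep levels the lines name (L1's level at the split place,
L3's localiser depths `Γ ∩ Γ(q₀^N)`, the TOWER reading of S11958) are intersections of `Γ` with principal congruence
subgroups.  This file proves, on the frozen target's own definitions, that such intersections ARE levels:
`principalCongruence c H N` is closed under products and under the inverse of an integral unitary matrix, contains `1`,
and `Γ(N₀ N) ⊆ Γ(N₀) ∩ Γ(N)`; so `Γ′ ∩ Γ(N)` is a congruence subgroup whenever `Γ′` is (`isCongruenceSubgroup_inter_principal`),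
and **`TargetData.IsLevel.inter_principal`** / **`TargetData.isLevel_inter_principal`** give `d.IsLevel (Γ′ ∩ Γ(N))`.  Also
`IsLevel.of_subset` (a level of a level is a level) and `principalCongruence_antitone`.

Nothing here says anything about the status of the Hodge conjecture for CM abelian varieties, which is NOT proved
(HC_CM is NOT proved by anyone in this repository).
-/

set_option autoImplicit false

noncomputable section

open Matrix NumberField

namespace Summit.Ventures.HodgeRepro.Tier4

section Principal

variable {E : Type} [Field E] {c : E ≃+* E} {H : Matrix (Fin 3) (Fin 3) E}

/-- The identity matrix is integral. -/
theorem isIntegralMatrix_one : IsIntegralMatrix (1 : Matrix (Fin 3) (Fin 3) E) := by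
  intro i j
  by_cases h : i = j
  · subst h; simp only [Matrix.one_apply_eq]; exact isIntegral_one
  · simp only [Matrix.one_apply_ne h]; exact isIntegral_zero

/-- Integral matrices are closed under products. -/
theorem IsIntegralMatrix.mul {g k : Matrix (Fin 3) (Fin 3) E} (hg : IsIntegralMatrix g) (hk : IsIntegralMatrix k) :
    IsIntegralMatrix (g * k) := by
  intro i j
  rw [Matrix.mul_apply]
  exact IsIntegral.sum _ fun l _ => (hg i l).mul (hk l j)

/-- `1 ∈ Γ(N)`. -/
theorem one_mem_principalCongruence (N : ℕ) : (1 : Matrix (Fin 3) (Fin 3) E) ∈ principalCongruence c H N :=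
  ⟨isUnitaryOf_one, isIntegralMatrix_one, fun i j => ⟨0, isIntegral_zero, by simp⟩⟩

/-- `Γ(N)` is closed under products. -/
theorem mul_mem_principalCongruence {N : ℕ} {g k : Matrix (Fin 3) (Fin 3) E} (hg : g ∈ principalCongruence c H N)
    (hk : k ∈ principalCongruence c H N) : g * k ∈ principalCongruence c H N := by
  obtain ⟨hgu, hgi, hgc⟩ := hg
  obtain ⟨hku, hki, hkc⟩ := hk
  refine ⟨hgu.mul hku, hgi.mul hki, fun i j => ?_⟩
  -- `g k − 1 = X + Y + X Y` for `X = g − 1`, `Y = k − 1`, every entry of the form `N · (integral)`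
  choose x hx using fun i j => hgc i j
  choose y hy using fun i j => hkc i j
  set X : Matrix (Fin 3) (Fin 3) E := Matrix.of fun a b => (N : E) * x a b with hX
  set Y : Matrix (Fin 3) (Fin 3) E := Matrix.of fun a b => (N : E) * y a b with hY
  have hg' : g = 1 + X := by
    ext a b
    rw [Matrix.add_apply, hX, Matrix.of_apply, ← (hx a b).2]
    ring
  have hk' : k = 1 + Y := by
    ext a b
    rw [Matrix.add_apply, hY, Matrix.of_apply, ← (hy a b).2]
    ring
  have hmul : g * k - 1 = X + Y + X * Y := by
    rw [hg', hk']
    noncomm_ring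
  have hentry := congrFun (congrFun hmul i) j
  rw [Matrix.sub_apply] at hentry
  rw [hentry]
  refine ⟨x i j + y i j + ∑ l, x i l * ((N : E) * y l j), ((hx i j).1.add (hy i j).1).add
    (IsIntegral.sum _ fun l _ => (hx i l).1.mul ((isIntegral_natCast N).mul (hy l j).1)), ?_⟩
  simp only [Matrix.add_apply, Matrix.mul_apply, hX, hY, Matrix.of_apply, Fin.sum_univ_three]
  ring

/-- The inverse of an element of `Γ(N)` that lies in `Γ(1)` lies in `Γ(N)`. -/
theorem inv_mem_principalCongruence {N : ℕ} {g k : Matrix (Fin 3) (Fin 3) E} (hg : g ∈ principalCongruence c H N)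
    (hk : k ∈ principalCongruence c H 1) (hkg : k * g = 1) : k ∈ principalCongruence c H N := by
  obtain ⟨_, _, hgc⟩ := hg
  obtain ⟨hku, hki, _⟩ := hk
  refine ⟨hku, hki, fun i j => ?_⟩
  -- `k − 1 = −k (g − 1)`
  choose x hx using fun i j => hgc i j
  set X : Matrix (Fin 3) (Fin 3) E := Matrix.of fun a b => (N : E) * x a b with hX
  have hg' : g = 1 + X := by
    ext a b
    rw [Matrix.add_apply, hX, Matrix.of_apply, ← (hx a b).2]
    ring
  have hsub : k - 1 = -(k * X) := by
    rw [hg', Matrix.mul_add, Matrix.mul_one] at hkg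
    rw [← hkg]
    noncomm_ring
  have hentry := congrFun (congrFun hsub i) j
  rw [Matrix.sub_apply] at hentry
  rw [hentry]
  refine ⟨-∑ l, k i l * x l j, (IsIntegral.sum _ fun l _ => (hki i l).mul (hx l j).1).neg, ?_⟩
  simp only [Matrix.neg_apply, Matrix.mul_apply, hX, Matrix.of_apply, Fin.sum_univ_three]
  ring

/-- `Γ(N₀ N) ⊆ Γ(N₀)`: a matrix congruent to `1` modulo `N₀ N` is congruent to `1` modulo `N₀`. -/
theorem principalCongruence_mul_subset_left (N₀ N : ℕ) :
    principalCongruence c H (N₀ * N) ⊆ principalCongruence c H N₀ := by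
  rintro g ⟨hgu, hgi, hgc⟩
  refine ⟨hgu, hgi, fun i j => ?_⟩
  obtain ⟨x, hx, hgx⟩ := hgc i j
  exact ⟨(N : E) * x, (isIntegral_natCast N).mul hx, by rw [hgx]; push_cast; ring⟩

/-- `Γ(N₀ N) ⊆ Γ(N)`. -/
theorem principalCongruence_mul_subset_right (N₀ N : ℕ) :
    principalCongruence c H (N₀ * N) ⊆ principalCongruence c H N := by
  rw [mul_comm]
  exact principalCongruence_mul_subset_left N N₀

/-- **`Γ′ ∩ Γ(N)` is a congruence subgroup whenever `Γ′` is** (`N ≥ 1`). -/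
theorem isCongruenceSubgroup_inter_principal {Γ' : Set (Matrix (Fin 3) (Fin 3) E)}
    (hΓ' : IsCongruenceSubgroup c H Γ') {N : ℕ} (hN : 1 ≤ N) :
    IsCongruenceSubgroup c H (Γ' ∩ principalCongruence c H N) := by
  obtain ⟨N₀, hN₀, hN₀Γ⟩ := hΓ'.2.2.2.2
  refine ⟨⟨hΓ'.one_mem, one_mem_principalCongruence N⟩, fun g hg k hk => ⟨hΓ'.mul_mem hg.1 hk.1,
    mul_mem_principalCongruence hg.2 hk.2⟩, fun g hg => ?_, fun g hg => hΓ'.2.2.2.1 hg.1, N₀ * N,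
    Nat.one_le_iff_ne_zero.2 (Nat.mul_ne_zero (by omega) (by omega)), fun g hg => ⟨hN₀Γ (principalCongruence_mul_subset_left N₀ N hg),
      principalCongruence_mul_subset_right N₀ N hg⟩⟩
  obtain ⟨k, hk, hgk, hkg⟩ := hΓ'.exists_inv hg.1
  exact ⟨k, ⟨hk, inv_mem_principalCongruence hg.2 (hΓ'.2.2.2.1 hk) hkg⟩, hgk⟩

end Principal

namespace TargetData

variable {F E : Type} [Field F] [NumberField F] [IsGalois ℚ F] [IsCMField F]
  [Field E] [NumberField E] [IsGalois ℚ E] [IsCMField E] (d : TargetData F E)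

/-- A level of a level is a level. -/
theorem IsLevel.of_subset {Γ' Γ'' : Set (Matrix (Fin 3) (Fin 3) E)} (hΓ' : d.IsLevel Γ')
    (hΓ'' : IsCongruenceSubgroup (conjE E) d.H Γ'') (hsub : Γ'' ⊆ Γ') : d.IsLevel Γ'' :=
  ⟨hΓ'', hsub.trans hΓ'.subset⟩

/-- **A deeper level**: `Γ′ ∩ Γ(N)` is a level whenever `Γ′` is (`N ≥ 1`). -/
theorem IsLevel.inter_principal {Γ' : Set (Matrix (Fin 3) (Fin 3) E)} (hΓ' : d.IsLevel Γ') {N : ℕ} (hN : 1 ≤ N) :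
    d.IsLevel (Γ' ∩ principalCongruence (conjE E) d.H N) :=
  hΓ'.of_subset d (isCongruenceSubgroup_inter_principal hΓ'.congr hN) Set.inter_subset_left

/-- `Γ ∩ Γ(N)` is a level of the datum (`N ≥ 1`). -/
theorem isLevel_inter_principal {N : ℕ} (hN : 1 ≤ N) : d.IsLevel (d.Γ ∩ principalCongruence (conjE E) d.H N) :=
  IsLevel.inter_principal d (Γ' := d.Γ) ⟨d.hΓ, subset_refl _⟩ hN

/-- `Γ ∩ Γ(N)` is contained in `Γ(N)`. -/
theorem inter_principal_subset (Γ' : Set (Matrix (Fin 3) (Fin 3) E)) (N : ℕ) :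
    Γ' ∩ principalCongruence (conjE E) d.H N ⊆ principalCongruence (conjE E) d.H N := Set.inter_subset_right

end TargetData

end Summit.Ventures.HodgeRepro.Tier4
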